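import Summits.NavierStokesRegularity.NavierStokesRegularity.Theorems.CorkscrewDynamoCorkscrewProfileNearIdentityRigidity
import HarnessLib

/-!
# Route CorkscrewDynamo · crux `CorkscrewProfile` (stmt-NavierStokesRegularity-11282) — the open stub reformulated
# (lead c4, line `registered`, tool stub F7)

`RssProfileExists` (stmt-NavierStokesRegularity-16274, the single open stub of the line) is EQUIVALENT to the near-identity
accumulation of nontrivial Type-I rotated-DSS ancient mild solutions about `e₃` at a bounded Type-I constant:
`→` an RSS profile turning at speed `α ≠ 0` is rotated `c`-DSS about `e₃` for EVERY factor `c > 0` (through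
`rotZLIE (−2α log c)`), nontrivial at `t = −1` where its slice is the continuous profile `U ≠ 0`; `←` is the near-identity
rigidity theorem `rssProfileExists_of_nearIdentity_rdss` (Dirichlet re-tuning of the angles, rate trichotomy, KNSS Lemma 6.1
compactness, Chae–Wolf for the self-similar branch).
-/

noncomputable section

open Set Function MeasureTheory Filter Topology Literature.Analysis.FluidPDE

namespace Summit.NavierStokesRegularity.NavierStokesRegularity.Theorems.CorkscrewProfile.Birth

set_option linter.dupNamespace false

/-- **An RSS profile gives near-identity rotated-DSS solutions** (the easy direction): for every `δ > 0` the RSS field of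
`RssProfileExists` is a nontrivial Type-I ancient mild solution rotated `c`-DSS about `e₃` with `c = 1 + δ/2`. -/
theorem nearIdentity_of_rssProfileExists
    (h : Summit.NavierStokesRegularity.NavierStokesRegularity.Theses.FilamentSkeletonRss.RssProfileExists) :
    ∃ C₀ : ℝ, ∀ δ : ℝ, 0 < δ →
      ∃ (c θ : ℝ) (u : ℝ → EuclideanSpace ℝ (Fin 3) → EuclideanSpace ℝ (Fin 3)), 1 < c ∧ c < 1 + δ ∧
        IsAncientMildSolution 1 u ∧ (∀ t < 0, AEStronglyMeasurable (u t) volume) ∧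
        IsRotatedDSS c (rotZLIE θ) u ∧ HasTypeIDecay C₀ u ∧ ¬ ∀ t < 0, u t =ᵐ[volume] 0 := by
  obtain ⟨α, C₀, U, Rot, u, -, hRot, hU2, hU0, hslice, hrdss, hmild, hmeas, hTI⟩ := h
  refine ⟨C₀, fun δ hδ => ⟨1 + δ / 2, -(α * (2 * Real.log (1 + δ / 2))), u, by linarith, by linarith, hmild, hmeas,
    ?_, hTI, fun hall => hU0 ?_⟩⟩
  · have hR : Rot (-(α * (2 * Real.log (1 + δ / 2)))) = rotZLIE (-(α * (2 * Real.log (1 + δ / 2)))) :=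
      LinearIsometryEquiv.ext fun x => by rw [rot_apply_eq_rotZ_of_basis hRot, rotZLIE_apply]
    exact hR ▸ hrdss (1 + δ / 2) (by linarith)
  · have hae := hall (-1) (by norm_num)
    rw [hslice] at hae
    exact (Continuous.ae_eq_iff_eq volume hU2.continuous continuous_const).1 hae

/-- **Registered tool stub F7 `stub_rssIffNearIdentity` — the open stub reformulated**: `RssProfileExists` iff nontrivial
Type-I rotated-DSS ancient mild solutions about `e₃` accumulate at factor `1` at some bounded Type-I constant. -/
theorem stub_rssIffNearIdentity :
    Summit.NavierStokesRegularity.NavierStokesRegularity.Theses.FilamentSkeletonRss.RssProfileExists ↔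
      ∃ C₀ : ℝ, ∀ δ : ℝ, 0 < δ →
        ∃ (c θ : ℝ) (u : ℝ → EuclideanSpace ℝ (Fin 3) → EuclideanSpace ℝ (Fin 3)), 1 < c ∧ c < 1 + δ ∧
          Literature.Analysis.FluidPDE.IsAncientMildSolution 1 u ∧
          (∀ t < 0, MeasureTheory.AEStronglyMeasurable (u t) MeasureTheory.volume) ∧
          Literature.Analysis.FluidPDE.IsRotatedDSS c (Literature.Analysis.FluidPDE.rotZLIE θ) u ∧
          Literature.Analysis.FluidPDE.HasTypeIDecay C₀ u ∧ ¬ ∀ t < 0, u t =ᵐ[MeasureTheory.volume] 0 := by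
  refine ⟨nearIdentity_of_rssProfileExists, fun ⟨C₀, h⟩ => ?_⟩
  have hpos : ∀ n : ℕ, (0 : ℝ) < 1 / ((n : ℝ) + 1) := fun n => by positivity
  choose c θ u hc1 hc2 hmild hmeas hrdss hTI hnz using fun n : ℕ => h (1 / ((n : ℝ) + 1)) (hpos n)
  have hclim : Tendsto c atTop (𝓝 1) := by
    have h0 : Tendsto (fun n : ℕ => (1 : ℝ) + 1 / ((n : ℝ) + 1)) atTop (𝓝 (1 + 0)) :=
      tendsto_const_nhds.add tendsto_one_div_add_atTop_nhds_zero_nat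
    rw [add_zero] at h0
    exact tendsto_of_tendsto_of_tendsto_of_le_of_le tendsto_const_nhds h0 (fun n => (hc1 n).le)
      (fun n => (hc2 n).le)
  exact rssProfileExists_of_nearIdentity_rdss C₀ c θ u hc1 hclim hmild hmeas hrdss hTI hnz

end Summit.NavierStokesRegularity.NavierStokesRegularity.Theorems.CorkscrewProfile.Birth

end
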